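import Summits.Schanuel.Schanuel.Theorems.ZilberEacParamFibreCurveSubleading
import Summits.Schanuel.Schanuel.Theorems.ZilberEacParamSurfaceDictionary
import Summits.Schanuel.Schanuel.Theorems.ZilberEacParamFibreCurveExamples
import HarnessLib

/-!
# Polynomially parametrised base curves, XXXII: the vanishing-phase class — complete theorem,
# literal capstone, and the examples `{x₀ = y₀², x₁ = i y₀⁴ + y₀³}`, `{x₀ = y₀², x₁ = √2 y₀² + y₀}`

HONEST FRAMING.  Cell `pub-schanuel` (Zilber's Exponential-Algebraic Closedness, case ladder;
host summit Schanuel), seat 2, gen 20.  Assembly of file XXXI (fibre curves, vanishing phase,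
sub-leading order) with gen 19 (two `y₁`-degrees), the trichotomy (file XXII) and the dictionary
lemma (file XXIV).  THEOREM (`unprojectedDensityQuestion_paramSurface₃_complete_of_subleading`):
`2 ≤ d = deg g₀ < n = deg g₁`, `d ∣ n`, `Re(lc(g₁)(i/lc(g₀))^{n/d}) = 0` and
`d lc(g₀)(g₁)_{n-1} ≠ n lc(g₁)(g₀)_{d-1}`; `Q ∈ ℂ[t, y₀, y₁]` irreducible with a zero in `(ℂˣ)²`
over infinitely many `t` ⟹ `S(g; Q)` case ∧ dense.  With file XXIV:
**`unprojectedDense_of_mmCase_of_base_eq_paramCurve₂`** — every `W` of Mantova–Masser's case whose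
base curve is `{(g₀(t), g₁(t))}` with `2 ≤ deg g₀ < deg g₁` and
[`d ∤ n` or `Re(lc(g₁)(i/lc(g₀))^{n/d}) ≠ 0` or `d lc(g₀)(g₁)_{n-1} ≠ n lc(g₁)(g₀)_{d-1}`] has
Zariski-dense exponential points; e.g. every `W` of the case over `(x₁ - i x₀²)² = x₀³`.  In plain
coordinates: `{x₀ = y₀², x₁ = i y₀⁴ + y₀³}` (vanishing phase, `2 ∣ 4`) and the CURVED REAL LINE
`{x₀ = y₀², x₁ = √2 y₀² + y₀}` (equal degrees, real irrational leading ratio) are in the case with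
dense exponential points.  What stays OPEN over polynomial curves: vanishing phase with
`d lc(g₀)(g₁)_{n-1} = n lc(g₁)(g₀)_{d-1}` (higher Puiseux orders), equal degrees with real ratio
and `Q` involving `y₁`, general algebraic curves; Fib(3,2); EC(3,2).  Mantova–Masser's question is
OPEN in general (PLMS 2024 §1 p. 5); NOT Schanuel's conjecture (neither used nor implied;
EAC ⇏ SC).
-/

noncomputable section

open Filter Topology Set Complex MvPolynomial
open Literature.NumberTheory.Transcendental Literature.ModelTheory.Zilber
open Literature.ModelTheory.ExponentialFields

set_option linter.dupNamespace false

namespace Summit.Schanuel.Schanuel.Theorems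

section Main

variable (g₀ g₁ : Polynomial ℂ) {Q : MvPolynomial (Fin 3) ℂ}

/-- **Complete theorem, vanishing phase (`2 ≤ deg g₀ < deg g₁`).**  `d ∣ n`,
`Re(lc(g₁)(i/lc(g₀))^{n/d}) = 0`, `d lc(g₀)(g₁)_{n-1} ≠ n lc(g₁)(g₀)_{d-1}`; `Q` irreducible with a
zero in `(ℂˣ)²` over infinitely many `t` ⟹ `S(g; Q)` is in Mantova–Masser's case AND dense.
[cite: MantovaMasser2023, §1 Further remarks, p. 5 (the question, open in general)] (new) -/
theorem unprojectedDensityQuestion_paramSurface₃_complete_of_subleading (hd : 2 ≤ g₀.natDegree)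
    (hlt : g₀.natDegree < g₁.natDegree) (hdvd : g₀.natDegree ∣ g₁.natDegree)
    (hph0 : (g₁.leadingCoeff * (I / g₀.leadingCoeff) ^ (g₁.natDegree / g₀.natDegree)).re = 0)
    (hsub : (g₀.natDegree : ℂ) * g₀.leadingCoeff * g₁.coeff (g₁.natDegree - 1) ≠
      (g₁.natDegree : ℂ) * g₁.leadingCoeff * g₀.coeff (g₀.natDegree - 1))
    (hirr : Irreducible Q)
    (hfib : Set.Infinite {t : ℂ | ∃ c : Fin 2 → ℂ, c 0 ≠ 0 ∧ c 1 ≠ 0 ∧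
      MvPolynomial.eval ![t, c 0, c 1] Q = 0}) :
    MMCaseDimPiOneFree {w : Fin 2 ⊕ Fin 2 → ℂ | ∃ t : ℂ, w (Sum.inl 0) = g₀.eval t ∧
        w (Sum.inl 1) = g₁.eval t ∧
        MvPolynomial.eval (Fin.cases t (fun i => w (Sum.inr i)) : Fin 3 → ℂ) Q = 0} ∧
      UnprojectedDense {w : Fin 2 ⊕ Fin 2 → ℂ | ∃ t : ℂ, w (Sum.inl 0) = g₀.eval t ∧
        w (Sum.inl 1) = g₁.eval t ∧
        MvPolynomial.eval (Fin.cases t (fun i => w (Sum.inr i)) : Fin 3 → ℂ) Q = 0} := by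
  rcases two_y1_degrees_or_y0_of_torusFibres hirr hfib with h2 | ⟨hQ2, h1⟩
  · exact unprojectedDensityQuestion_instance_paramSurface₃ g₀ g₁ (by omega) hlt hirr h2 hfib
  · exact unprojectedDensityQuestion_instance_paramSurface₃_of_y0_subleading g₀ g₁ hd (by omega)
      hdvd hph0 hsub hirr hQ2 h1 (fibreRoots_infinite_of_torusFibres hQ2 hfib)

/-- **Complete theorem over a polynomial curve with `2 ≤ deg g₀ < deg g₁`, both orders.**  One of:
`d ∤ n`; `Re(lc(g₁)(i/lc(g₀))^{n/d}) ≠ 0`; `d lc(g₀)(g₁)_{n-1} ≠ n lc(g₁)(g₀)_{d-1}` — then every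
irreducible `Q` with a zero in `(ℂˣ)²` over infinitely many `t` gives a surface of the case with
dense exponential points. [cite: MantovaMasser2023, §1 Further remarks, p. 5 (the question, open in
general)] (new) -/
theorem unprojectedDensityQuestion_paramSurface₃_complete₂ (hd : 2 ≤ g₀.natDegree)
    (hlt : g₀.natDegree < g₁.natDegree)
    (h : ¬ g₀.natDegree ∣ g₁.natDegree ∨
      (g₁.leadingCoeff * (I / g₀.leadingCoeff) ^ (g₁.natDegree / g₀.natDegree)).re ≠ 0 ∨
      (g₀.natDegree : ℂ) * g₀.leadingCoeff * g₁.coeff (g₁.natDegree - 1) ≠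
        (g₁.natDegree : ℂ) * g₁.leadingCoeff * g₀.coeff (g₀.natDegree - 1))
    (hirr : Irreducible Q)
    (hfib : Set.Infinite {t : ℂ | ∃ c : Fin 2 → ℂ, c 0 ≠ 0 ∧ c 1 ≠ 0 ∧
      MvPolynomial.eval ![t, c 0, c 1] Q = 0}) :
    MMCaseDimPiOneFree {w : Fin 2 ⊕ Fin 2 → ℂ | ∃ t : ℂ, w (Sum.inl 0) = g₀.eval t ∧
        w (Sum.inl 1) = g₁.eval t ∧
        MvPolynomial.eval (Fin.cases t (fun i => w (Sum.inr i)) : Fin 3 → ℂ) Q = 0} ∧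
      UnprojectedDense {w : Fin 2 ⊕ Fin 2 → ℂ | ∃ t : ℂ, w (Sum.inl 0) = g₀.eval t ∧
        w (Sum.inl 1) = g₁.eval t ∧
        MvPolynomial.eval (Fin.cases t (fun i => w (Sum.inr i)) : Fin 3 → ℂ) Q = 0} := by
  by_cases hph : ¬ g₀.natDegree ∣ g₁.natDegree ∨
      (g₁.leadingCoeff * (I / g₀.leadingCoeff) ^ (g₁.natDegree / g₀.natDegree)).re ≠ 0
  · exact unprojectedDensityQuestion_paramSurface₃_complete g₀ g₁ hd hlt hph hirr hfib
  · push Not at hph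
    obtain ⟨hdvd, hph0⟩ := hph
    have hsub : (g₀.natDegree : ℂ) * g₀.leadingCoeff * g₁.coeff (g₁.natDegree - 1) ≠
        (g₁.natDegree : ℂ) * g₁.leadingCoeff * g₀.coeff (g₀.natDegree - 1) := by
      rcases h with h | h | h
      · exact absurd hdvd h
      · exact absurd hph0 h
      · exact h
    exact unprojectedDensityQuestion_paramSurface₃_complete_of_subleading g₀ g₁ hd hlt hdvd hph0
      hsub hirr hfib

/-- **LITERAL CAPSTONE, both orders.**  Every `W ⊆ ℂ² × ℂ²` in Mantova–Masser's case
(dim-π-S-1-free) whose base curve is `{(g₀(t), g₁(t))}` with `2 ≤ deg g₀ < deg g₁` and one of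
`d ∤ n`, `Re(lc(g₁)(i/lc(g₀))^{n/d}) ≠ 0`, `d lc(g₀)(g₁)_{n-1} ≠ n lc(g₁)(g₀)_{d-1}` has Zariski-dense
exponential points. [cite: MantovaMasser2023, §1 Further remarks, p. 5 (the question, open in
general)] (new) -/
theorem unprojectedDense_of_mmCase_of_base_eq_paramCurve₂ (hd : 2 ≤ g₀.natDegree)
    (hlt : g₀.natDegree < g₁.natDegree)
    (h : ¬ g₀.natDegree ∣ g₁.natDegree ∨
      (g₁.leadingCoeff * (I / g₀.leadingCoeff) ^ (g₁.natDegree / g₀.natDegree)).re ≠ 0 ∨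
      (g₀.natDegree : ℂ) * g₀.leadingCoeff * g₁.coeff (g₁.natDegree - 1) ≠
        (g₁.natDegree : ℂ) * g₁.leadingCoeff * g₀.coeff (g₀.natDegree - 1))
    {W : Set (Fin 2 ⊕ Fin 2 → ℂ)} (hmm : MMCaseDimPiOneFree W)
    (hbase : zeroLocus ℂ (vanishingIdeal ℂ (projAdd '' (W ∩ torusLocus ℂ 2))) =
      {x : Fin 2 → ℂ | ∃ t : ℂ, x 0 = g₀.eval t ∧ x 1 = g₁.eval t}) :
    UnprojectedDense W := by
  obtain ⟨Q, hQ, hfib, rfl⟩ := exists_eq_paramSurface₃_of_mmCase g₀ g₁ (by omega) hmm hbase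
  exact (unprojectedDensityQuestion_paramSurface₃_complete₂ g₀ g₁ hd hlt h hQ hfib).2

/-- **LITERAL CAPSTONE, both orders, mirror** (`2 ≤ deg g₁ < deg g₀`). [cite: MantovaMasser2023,
§1 Further remarks, p. 5 (the question, open in general)] (new) -/
theorem unprojectedDense_of_mmCase_of_base_eq_paramCurve₂_of_gt (hd : 2 ≤ g₁.natDegree)
    (hlt : g₁.natDegree < g₀.natDegree)
    (h : ¬ g₁.natDegree ∣ g₀.natDegree ∨
      (g₀.leadingCoeff * (I / g₁.leadingCoeff) ^ (g₀.natDegree / g₁.natDegree)).re ≠ 0 ∨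
      (g₁.natDegree : ℂ) * g₁.leadingCoeff * g₀.coeff (g₀.natDegree - 1) ≠
        (g₀.natDegree : ℂ) * g₀.leadingCoeff * g₁.coeff (g₁.natDegree - 1))
    {W : Set (Fin 2 ⊕ Fin 2 → ℂ)} (hmm : MMCaseDimPiOneFree W)
    (hbase : zeroLocus ℂ (vanishingIdeal ℂ (projAdd '' (W ∩ torusLocus ℂ 2))) =
      {x : Fin 2 → ℂ | ∃ t : ℂ, x 0 = g₀.eval t ∧ x 1 = g₁.eval t}) :
    UnprojectedDense W := by
  obtain ⟨Q, hQ, hfib, rfl⟩ := exists_eq_paramSurface₃_of_mmCase g₀ g₁ (by omega) hmm hbase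
  obtain ⟨-, hdns⟩ := unprojectedDensityQuestion_paramSurface₃_complete₂ g₁ g₀ hd hlt h
    (irreducible_rename_swap12 hQ) (torusFibres_rename_swap12 hfib)
  rw [paramSurface₃_eq_indexSwapped, unprojectedDense_indexSwapped_iff]
  exact hdns

end Main

/-! ## Fibre curves `P(t, y₀) = 0` in plain coordinates, vanishing phase -/

section Plain

variable {g₀ g₁ : Polynomial ℂ} {P : MvPolynomial (Fin 2) ℂ}

/-- **Case ∧ dense for fibre curves `P(t, y₀) = 0` over a polynomial curve, vanishing phase**
(plain coordinates): `d = deg g₀ ≥ 2`, `n = deg g₁ ≥ 1`, `d ∣ n`, `Re(lc(g₁)(i/lc(g₀))^{n/d}) = 0`,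
`d lc(g₀)(g₁)_{n-1} ≠ n lc(g₁)(g₀)_{d-1}`, `P` irreducible with two `y₀`-degrees and nonzero fibre
roots over infinitely many `t`. [cite: MantovaMasser2023, §1 Further remarks, p. 5 (the question,
open in general)] (new) -/
theorem unprojectedDensityQuestion_instance_paramFibreCurve_subleading (hd : 2 ≤ g₀.natDegree)
    (hn : 1 ≤ g₁.natDegree) (hdvd : g₀.natDegree ∣ g₁.natDegree)
    (hph0 : (g₁.leadingCoeff * (I / g₀.leadingCoeff) ^ (g₁.natDegree / g₀.natDegree)).re = 0)
    (hsub : (g₀.natDegree : ℂ) * g₀.leadingCoeff * g₁.coeff (g₁.natDegree - 1) ≠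
      (g₁.natDegree : ℂ) * g₁.leadingCoeff * g₀.coeff (g₀.natDegree - 1))
    (hirr : Irreducible P) (h1 : ∃ v ∈ P.support, ∃ v' ∈ P.support, v 1 ≠ v' 1)
    (hfib : Set.Infinite {t : ℂ | ∃ y : ℂ, y ≠ 0 ∧ MvPolynomial.eval ![t, y] P = 0}) :
    MMCaseDimPiOneFree {w : Fin 2 ⊕ Fin 2 → ℂ | ∃ t : ℂ, w (Sum.inl 0) = g₀.eval t ∧
        w (Sum.inl 1) = g₁.eval t ∧ MvPolynomial.eval ![t, w (Sum.inr 0)] P = 0} ∧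
      UnprojectedDense {w : Fin 2 ⊕ Fin 2 → ℂ | ∃ t : ℂ, w (Sum.inl 0) = g₀.eval t ∧
        w (Sum.inl 1) = g₁.eval t ∧ MvPolynomial.eval ![t, w (Sum.inr 0)] P = 0} := by
  rw [paramFibreCurveSurface_eq]
  refine unprojectedDensityQuestion_instance_paramSurface₃_of_y0_subleading g₀ g₁ hd hn hdvd hph0
    hsub (irreducible_rename_castSucc₂ hirr) (support_rename_castSucc_y1 P)
    (exists_support_rename_castSucc_y0 h1) (hfib.mono ?_)
  rintro t ⟨y, hy, hty⟩
  exact ⟨y, hy, by rw [eval_vec3_rename_castSucc]; exact hty⟩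

end Plain

/-! ## Examples -/

section Examples

/-- `deg (i X⁴ + X³) = 4`. -/
theorem natDegree_C_I_mul_X_pow_four_add_X_cube :
    (Polynomial.C I * Polynomial.X ^ 4 + Polynomial.X ^ 3 : Polynomial ℂ).natDegree = 4 := by
  rw [Polynomial.natDegree_add_eq_left_of_natDegree_lt] <;>
    simp [Polynomial.natDegree_C_mul_X_pow 4 I I_ne_zero]

/-- `lc (i X⁴ + X³) = i`. -/
theorem leadingCoeff_C_I_mul_X_pow_four_add_X_cube :
    (Polynomial.C I * Polynomial.X ^ 4 + Polynomial.X ^ 3 : Polynomial ℂ).leadingCoeff = I := by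
  rw [Polynomial.leadingCoeff, natDegree_C_I_mul_X_pow_four_add_X_cube]
  simp [Polynomial.coeff_X_pow]

/-- **Example (vanishing phase, `2 ∣ 4`).**  The surface `{(t², i t⁴ + t³, y₀, y₁) : y₀ = t}`,
i.e. `{x₀ = y₀², x₁ = i y₀⁴ + y₀³}`, is in Mantova–Masser's case and its exponential points
(`e^{y²} = y`) are Zariski dense: here `Re(i · i²) = 0` but `2 · 1 · 1 ≠ 4 · i · 0`. (new) -/
theorem unprojectedDensityQuestion_instance_iQuartic_y0_eq_t :
    MMCaseDimPiOneFree {w : Fin 2 ⊕ Fin 2 → ℂ | ∃ t : ℂ,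
        w (Sum.inl 0) = (Polynomial.X ^ 2 : Polynomial ℂ).eval t ∧
        w (Sum.inl 1) = (Polynomial.C I * Polynomial.X ^ 4 + Polynomial.X ^ 3 : Polynomial ℂ).eval t ∧
        MvPolynomial.eval ![t, w (Sum.inr 0)] (X 1 - X 0 : MvPolynomial (Fin 2) ℂ) = 0} ∧
      UnprojectedDense {w : Fin 2 ⊕ Fin 2 → ℂ | ∃ t : ℂ,
        w (Sum.inl 0) = (Polynomial.X ^ 2 : Polynomial ℂ).eval t ∧
        w (Sum.inl 1) = (Polynomial.C I * Polynomial.X ^ 4 + Polynomial.X ^ 3 : Polynomial ℂ).eval t ∧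
        MvPolynomial.eval ![t, w (Sum.inr 0)] (X 1 - X 0 : MvPolynomial (Fin 2) ℂ) = 0} := by
  have hd2 : (Polynomial.X ^ 2 : Polynomial ℂ).natDegree = 2 := by simp
  have hlc2 : (Polynomial.X ^ 2 : Polynomial ℂ).leadingCoeff = 1 := by simp
  refine unprojectedDensityQuestion_instance_paramFibreCurve_subleading (by rw [hd2])
    (by rw [natDegree_C_I_mul_X_pow_four_add_X_cube]; norm_num)
    (by rw [hd2, natDegree_C_I_mul_X_pow_four_add_X_cube]; norm_num) ?_ ?_
    irreducible_X1_sub_X0 X1_sub_X0_support_pair X1_sub_X0_fibres_infinite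
  · rw [hd2, hlc2, natDegree_C_I_mul_X_pow_four_add_X_cube,
      leadingCoeff_C_I_mul_X_pow_four_add_X_cube]
    norm_num [Complex.I_sq]
  · rw [hd2, hlc2, natDegree_C_I_mul_X_pow_four_add_X_cube,
      leadingCoeff_C_I_mul_X_pow_four_add_X_cube]
    simp [Polynomial.coeff_X_pow, Polynomial.coeff_C_mul]

/-- `deg (√2 X² + X) = 2`. -/
theorem natDegree_sqrtTwo_X_sq_add_X :
    (Polynomial.C ((Real.sqrt 2 : ℝ) : ℂ) * Polynomial.X ^ 2 + Polynomial.X : Polynomial ℂ).natDegree =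
      2 := by
  have h0 : ((Real.sqrt 2 : ℝ) : ℂ) ≠ 0 := by
    rw [Complex.ofReal_ne_zero]; positivity
  rw [Polynomial.natDegree_add_eq_left_of_natDegree_lt] <;>
    simp [Polynomial.natDegree_C_mul_X_pow 2 _ h0]

/-- `lc (√2 X² + X) = √2`. -/
theorem leadingCoeff_sqrtTwo_X_sq_add_X :
    (Polynomial.C ((Real.sqrt 2 : ℝ) : ℂ) * Polynomial.X ^ 2 + Polynomial.X :
      Polynomial ℂ).leadingCoeff = ((Real.sqrt 2 : ℝ) : ℂ) := by
  rw [Polynomial.leadingCoeff, natDegree_sqrtTwo_X_sq_add_X]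
  simp [Polynomial.coeff_X]

/-- **Example (a CURVED real line: equal degrees, real irrational leading ratio).**  The surface
`{(t², √2 t² + t, y₀, y₁) : y₀ = t}`, i.e. `{x₀ = y₀², x₁ = √2 y₀² + y₀}` over the curve
`(x₁ - √2 x₀)² = x₀`, is in Mantova–Masser's case and its exponential points are Zariski dense
(`Re(√2 · i) = 0` but `1 · 1 ≠ √2 · 0`). (new) -/
theorem unprojectedDensityQuestion_instance_sqrtTwoCurve_y0_eq_t :
    MMCaseDimPiOneFree {w : Fin 2 ⊕ Fin 2 → ℂ | ∃ t : ℂ,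
        w (Sum.inl 0) = (Polynomial.X ^ 2 : Polynomial ℂ).eval t ∧
        w (Sum.inl 1) = (Polynomial.C ((Real.sqrt 2 : ℝ) : ℂ) * Polynomial.X ^ 2 + Polynomial.X :
          Polynomial ℂ).eval t ∧
        MvPolynomial.eval ![t, w (Sum.inr 0)] (X 1 - X 0 : MvPolynomial (Fin 2) ℂ) = 0} ∧
      UnprojectedDense {w : Fin 2 ⊕ Fin 2 → ℂ | ∃ t : ℂ,
        w (Sum.inl 0) = (Polynomial.X ^ 2 : Polynomial ℂ).eval t ∧
        w (Sum.inl 1) = (Polynomial.C ((Real.sqrt 2 : ℝ) : ℂ) * Polynomial.X ^ 2 + Polynomial.X :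
          Polynomial ℂ).eval t ∧
        MvPolynomial.eval ![t, w (Sum.inr 0)] (X 1 - X 0 : MvPolynomial (Fin 2) ℂ) = 0} := by
  have hd2 : (Polynomial.X ^ 2 : Polynomial ℂ).natDegree = 2 := by simp
  have hlc2 : (Polynomial.X ^ 2 : Polynomial ℂ).leadingCoeff = 1 := by simp
  refine unprojectedDensityQuestion_instance_paramFibreCurve_subleading (by rw [hd2])
    (by rw [natDegree_sqrtTwo_X_sq_add_X]; norm_num)
    (by rw [hd2, natDegree_sqrtTwo_X_sq_add_X]) ?_ ?_
    irreducible_X1_sub_X0 X1_sub_X0_support_pair X1_sub_X0_fibres_infinite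
  · rw [hd2, hlc2, natDegree_sqrtTwo_X_sq_add_X, leadingCoeff_sqrtTwo_X_sq_add_X]
    simp
  · rw [hd2, hlc2, natDegree_sqrtTwo_X_sq_add_X, leadingCoeff_sqrtTwo_X_sq_add_X]
    simp [Polynomial.coeff_X_pow, Polynomial.coeff_C_mul, Polynomial.coeff_X]

/-- The curve `(x₁ - i x₀²)² = x₀³` is `{(t², i t⁴ + t³)}`. -/
theorem iQuarticCurve_eq_paramCurve :
    {x : Fin 2 → ℂ | (x 1 - I * x 0 ^ 2) ^ 2 = x 0 ^ 3} =
      {x : Fin 2 → ℂ | ∃ t : ℂ, x 0 = (Polynomial.X ^ 2 : Polynomial ℂ).eval t ∧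
        x 1 = (Polynomial.C I * Polynomial.X ^ 4 + Polynomial.X ^ 3 : Polynomial ℂ).eval t} := by
  ext x
  simp only [Set.mem_setOf_eq, Polynomial.eval_pow, Polynomial.eval_X, Polynomial.eval_add,
    Polynomial.eval_mul, Polynomial.eval_C]
  constructor
  · intro h
    by_cases hx0 : x 0 = 0
    · refine ⟨0, by simp [hx0], ?_⟩
      have : (x 1) ^ 2 = 0 := by simpa [hx0] using h
      simp [pow_eq_zero_iff two_ne_zero |>.1 this]
    · -- `t = (x₁ - i x₀²)/x₀`: `t² = x₀³/x₀² = x₀`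
      refine ⟨(x 1 - I * x 0 ^ 2) / x 0, ?_, ?_⟩
      · field_simp
        linear_combination -h
      · have ht2 : ((x 1 - I * x 0 ^ 2) / x 0) ^ 2 = x 0 := by
          field_simp
          linear_combination h
        have ht3 : ((x 1 - I * x 0 ^ 2) / x 0) ^ 3 = x 1 - I * x 0 ^ 2 := by
          rw [pow_succ, ht2]; field_simp
        have ht4 : ((x 1 - I * x 0 ^ 2) / x 0) ^ 4 = x 0 ^ 2 := by
          rw [show (4 : ℕ) = 2 * 2 by norm_num, pow_mul, ht2]
        rw [ht4, ht3]; ring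
  · rintro ⟨t, h0, h1⟩
    rw [h1, h0]; ring

/-- **Every `W` of Mantova–Masser's case whose base curve is `(x₁ - i x₀²)² = x₀³` has
Zariski-dense exponential points** (vanishing phase `Re(i · i²) = 0`, sub-leading coefficients
`2 · 1 · 1 ≠ 4 · i · 0`). [cite: MantovaMasser2023, §1 Further remarks, p. 5 (the question, open
in general)] (new) -/
theorem unprojectedDense_of_mmCase_of_base_eq_iQuarticCurve {W : Set (Fin 2 ⊕ Fin 2 → ℂ)}
    (hmm : MMCaseDimPiOneFree W)
    (hbase : zeroLocus ℂ (vanishingIdeal ℂ (projAdd '' (W ∩ torusLocus ℂ 2))) =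
      {x : Fin 2 → ℂ | (x 1 - I * x 0 ^ 2) ^ 2 = x 0 ^ 3}) :
    UnprojectedDense W := by
  rw [iQuarticCurve_eq_paramCurve] at hbase
  have hd2 : (Polynomial.X ^ 2 : Polynomial ℂ).natDegree = 2 := by simp
  have hlc2 : (Polynomial.X ^ 2 : Polynomial ℂ).leadingCoeff = 1 := by simp
  refine unprojectedDense_of_mmCase_of_base_eq_paramCurve₂ (Polynomial.X ^ 2)
    (Polynomial.C I * Polynomial.X ^ 4 + Polynomial.X ^ 3) (by rw [hd2])
    (by rw [hd2, natDegree_C_I_mul_X_pow_four_add_X_cube]; norm_num) (Or.inr (Or.inr ?_)) hmm hbase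
  rw [hd2, hlc2, natDegree_C_I_mul_X_pow_four_add_X_cube, leadingCoeff_C_I_mul_X_pow_four_add_X_cube]
  simp [Polynomial.coeff_X_pow, Polynomial.coeff_C_mul]

end Examples

end Summit.Schanuel.Schanuel.Theorems
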